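import Literature.Analysis.FluidPDE.AxisymNoSwirlVorticity
import Literature.Analysis.FluidPDE.KNSSAxisymmetricNoSwirl
import HarnessLib

/-!
# KNSS 2009, Theorem 5.2: from the `L^∞` hypotheses to the smooth representative

Analysis/FluidPDE support file (all results proved) on the decomposition path of the named fact
`Literature.Analysis.FluidPDE.KNSS2009_liouville_axisymmetric_no_swirl` (Koch–Nadirashvili–
Seregin–Šverák, *Liouville theorems for the Navier–Stokes equations and applications*, Acta
Math. 203 (2009) = arXiv:0709.3599, **Theorem 5.2**). The theorem is stated for an `L^∞` weak
solution `u` with a.e. hypotheses (for every angle `θ`, `u(t, R_θ x) = R_θ u(t, x)` a.e. in `x`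
for a.e. `t < 0`; `swirl (u t) = 0` a.e. for a.e. `t`), while the printed proof (p. 10) works
with the smooth representative of §4 (`KNSS2009_regularity_boundedWeak_ancient`,
`KNSSRegularity`: `u(t, ·) = U(t, ·) + b(t)` a.e. for a.e. `t < 0`, smooth slices, first
derivatives Lipschitz in time). This file supplies the glue between the two, in the hypothesis
shapes of the fact and of `integral_scalarEq_of_vorticityEq` (`AxisymNoSwirlScalarEq`):

* `isAxisymmetric_of_ae_rat`, `hasNoSwirl_of_ae`: a continuous field a.e. equivariant under the
  rotations by rational angles (resp. with a.e. vanishing swirl) is axisymmetric (resp. swirl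
  free) — continuity and density of `ℚ` in the angle;
* `ae_isAxisymmetric_hasNoSwirl_repr` (**good times**): for a.e. `t < 0` the continuous field
  `V(t, ·) = U(t, ·) + b(t)` is pointwise axisymmetric and swirl free;
* `ae_fderiv_rotGen_eq_repr`: hence for a.e. `t < 0`, `DU(t)(x)[Jx] = J(U(t, x) + b(t))` for all
  `x` (the drift hypothesis `hax` of `integral_scalarEq_of_vorticityEq`);
* `continuousOn_curl_of_lipschitz`: the vorticity `curl U(t)(x)` is continuous in `t < 0` when
  the first derivatives are Lipschitz in time (clause `k = 1` of the §4 fact);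
* `curl_structure_of_ae_repr` (**every time**): `ω₂ = 0` and `x₀ω₀ + x₁ω₁ = 0` for
  `ω = curl U(t, ·)` at *every* `t < 0` (at good times by `AxisymNoSwirlVorticity`, at the others
  by continuity in time: the exceptional times are a null, hence nowhere dense, set) — the
  hypotheses `h2`, `hb` of `integral_scalarEq_of_vorticityEq`, which are needed on whole time
  intervals.

## References

* G. Koch, N. Nadirashvili, G. Seregin, V. Šverák, *Liouville theorems for the Navier–Stokes
  equations and applications*, Acta Math. 203 (2009) 83–105 = arXiv:0709.3599: Theorem 5.2 and
  its proof (pp. 9–10), §4 (p. 8). [KochNadirashviliSereginSverak2009]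
-/

noncomputable section

open MeasureTheory Set Function Filter Topology
open scoped RealInnerProductSpace ContDiff

namespace Literature.Analysis.FluidPDE

/-! ### Continuous fields: a.e. symmetry is symmetry -/

/-- A continuous field on `ℝ³` which is a.e. equivariant under the rotations by all *rational*
angles is axisymmetric: for each rational angle the two continuous sides agree everywhere
(`Continuous.ae_eq_iff_eq`), and rational angles are dense. [folklore] -/
theorem isAxisymmetric_of_ae_rat {V : EuclideanSpace ℝ (Fin 3) → EuclideanSpace ℝ (Fin 3)}
    (hV : Continuous V)
    (h : ∀ q : ℚ, (fun x => V (rotZ (q : ℝ) x)) =ᵐ[volume] fun x => rotZ (q : ℝ) (V x)) :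
    IsAxisymmetric V := by
  have hrot : ∀ θ : ℝ, Continuous (rotZ θ) := fun θ => (rotZLIE θ).continuous
  -- rational angles: everywhere
  have hq : ∀ q : ℚ, ∀ x, V (rotZ (q : ℝ) x) = rotZ (q : ℝ) (V x) := fun q =>
    congrFun (((hV.comp (hrot q)).ae_eq_iff_eq volume ((hrot q).comp hV)).1 (h q))
  -- density in the angle
  intro θ x
  have hc0 : Continuous fun s : ℝ => rotZ s x :=
    continuous_iff_continuousAt.2 fun s => (hasDerivAt_rotZ x s).continuousAt
  have hc1 : Continuous fun s : ℝ => V (rotZ s x) := hV.comp hc0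
  have hc2 : Continuous fun s : ℝ => rotZ s (V x) :=
    continuous_iff_continuousAt.2 fun s => (hasDerivAt_rotZ (V x) s).continuousAt
  have hdense : Dense (range ((↑) : ℚ → ℝ)) := Rat.denseRange_cast
  have heq : EqOn (fun s : ℝ => V (rotZ s x)) (fun s => rotZ s (V x)) (range ((↑) : ℚ → ℝ)) := by
    rintro _ ⟨q, rfl⟩
    exact hq q x
  exact congrFun (Continuous.ext_on hdense hc1 hc2 heq) θ

/-- A continuous field on `ℝ³` whose swirl vanishes a.e. is swirl free. [folklore] -/
theorem hasNoSwirl_of_ae {V : EuclideanSpace ℝ (Fin 3) → EuclideanSpace ℝ (Fin 3)} (hV : Continuous V)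
    (h : swirl V =ᵐ[volume] (0 : EuclideanSpace ℝ (Fin 3) → ℝ)) : HasNoSwirl V := by
  have hc : Continuous (swirl V) := by
    unfold swirl
    fun_prop
  exact congrFun ((hc.ae_eq_iff_eq volume continuous_const).1 h)

/-! ### Good times: the smooth representative inherits the `L^∞` symmetry hypotheses -/

/-- **Good times.** Let `u : ℝ → ℝ³ → ℝ³` satisfy the `L^∞` hypotheses of KNSS's Theorem 5.2 —
for every angle `θ`, `u(t, R_θ x) = R_θ u(t, x)` for a.e. `x`, for a.e. `t < 0`, and
`swirl (u t) = 0` a.e. for a.e. `t < 0` — and let `u(t, ·) = U(t, ·) + b(t)` a.e. for a.e.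
`t < 0` with continuous slices `U(t, ·)` (the representative of the regularity theory of §4,
`KNSS2009_regularity_boundedWeak_ancient`). Then for a.e. `t < 0` the continuous field
`V(t, ·) = U(t, ·) + b(t)` is (pointwise) axisymmetric and swirl free (countably many rational
angles suffice by density, `isAxisymmetric_of_ae_rat`; the a.e. identities transfer from `u t`
to `V t` along the measure-preserving rotations). This is the form in which the printed proof
uses the hypotheses ("Assume that `u` is axi-symmetric with no swirl", for the smooth solution of
§4). [cite: KochNadirashviliSereginSverak2009, Thm 5.2 and §4 (arXiv pp. 8–10)] -/
theorem ae_isAxisymmetric_hasNoSwirl_repr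
    {u U : ℝ → EuclideanSpace ℝ (Fin 3) → EuclideanSpace ℝ (Fin 3)} {b : ℝ → EuclideanSpace ℝ (Fin 3)}
    (haxi : ∀ θ : ℝ, ∀ᵐ t ∂((volume : Measure ℝ).restrict (Iio 0)),
      (fun x => u t (rotZ θ x)) =ᵐ[volume] fun x => rotZ θ (u t x))
    (hswirl : ∀ᵐ t ∂((volume : Measure ℝ).restrict (Iio 0)),
      swirl (u t) =ᵐ[volume] (0 : EuclideanSpace ℝ (Fin 3) → ℝ))
    (hae : ∀ᵐ t ∂((volume : Measure ℝ).restrict (Iio 0)), u t =ᵐ[volume] fun x => U t x + b t)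
    (hcont : ∀ t < 0, Continuous (U t)) :
    ∀ᵐ t ∂((volume : Measure ℝ).restrict (Iio 0)),
      IsAxisymmetric (fun x => U t x + b t) ∧ HasNoSwirl (fun x => U t x + b t) := by
  have hq : ∀ᵐ t ∂((volume : Measure ℝ).restrict (Iio 0)), ∀ q : ℚ,
      (fun x => u t (rotZ (q : ℝ) x)) =ᵐ[volume] fun x => rotZ (q : ℝ) (u t x) :=
    ae_all_iff.2 fun q => haxi q
  filter_upwards [hq, hswirl, hae, ae_restrict_mem measurableSet_Iio] with t hqt hst hut ht
  have ht' : t < 0 := ht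
  have hVc : Continuous fun x => U t x + b t := (hcont t ht').add continuous_const
  refine ⟨isAxisymmetric_of_ae_rat hVc fun q => ?_, hasNoSwirl_of_ae hVc ?_⟩
  · have h1 : (fun x => u t (rotZ (q : ℝ) x)) =ᵐ[volume] fun x => U t (rotZ (q : ℝ) x) + b t :=
      (measurePreserving_rotZ (q : ℝ)).quasiMeasurePreserving.ae_eq hut
    have h2 : (fun x => rotZ (q : ℝ) (u t x)) =ᵐ[volume] fun x => rotZ (q : ℝ) (U t x + b t) := by
      filter_upwards [hut] with x hx
      rw [hx]
    exact h1.symm.trans ((hqt q).trans h2)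
  · have h3 : swirl (u t) =ᵐ[volume] swirl fun x => U t x + b t := by
      filter_upwards [hut] with x hx
      simp only [swirl, hx]
    exact h3.symm.trans hst

/-- **Infinitesimal axisymmetry of the drift at good times**: under the conclusion of
`ae_isAxisymmetric_hasNoSwirl_repr`, with differentiable slices, for a.e. `t < 0` one has
`DU(t)(x)[Jx] = J (U(t, x) + b(t))` for every `x` (`Fluid.IsAxisymmetric.fderiv_rotGen` for
`V = U + b`, whose Jacobian is that of `U`) — the hypothesis `hax` of
`integral_scalarEq_of_vorticityEq` (`AxisymNoSwirlScalarEq`). [folklore] -/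
theorem ae_fderiv_rotGen_eq_repr
    {U : ℝ → EuclideanSpace ℝ (Fin 3) → EuclideanSpace ℝ (Fin 3)} {b : ℝ → EuclideanSpace ℝ (Fin 3)}
    (hdiff : ∀ t < 0, Differentiable ℝ (U t))
    (hgood : ∀ᵐ t ∂((volume : Measure ℝ).restrict (Iio 0)), IsAxisymmetric fun x => U t x + b t) :
    ∀ᵐ t ∂((volume : Measure ℝ).restrict (Iio 0)), ∀ x,
      fderiv ℝ (U t) x (rotGen x) = rotGen (U t x + b t) := by
  filter_upwards [hgood, ae_restrict_mem measurableSet_Iio] with t hax ht x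
  have ht' : t < 0 := ht
  have hd : DifferentiableAt ℝ (fun y => U t y + b t) x := (hdiff t ht' x).add_const _
  have h := hax.fderiv_rotGen hd
  rwa [fderiv_add_const] at h

/-! ### All times: the structure of the vorticity persists by continuity in time -/

/-- A function continuous on `(−∞, 0)` which vanishes at a.e. `t < 0` vanishes at every `t < 0`
(`Measure.eqOn_open_of_ae_eq`). [folklore] -/
theorem forall_eq_zero_of_ae_restrict_Iio {F : Type*} [NormedAddCommGroup F] {φ : ℝ → F}
    (hφ : ContinuousOn φ (Iio 0))
    (h : ∀ᵐ t ∂((volume : Measure ℝ).restrict (Iio 0)), φ t = 0) : ∀ t < 0, φ t = 0 :=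
  fun _ ht => Measure.eqOn_open_of_ae_eq h isOpen_Iio hφ continuousOn_const ht

/-- Uniformly Lipschitz first derivatives make the vorticity continuous in time: if
`‖∇U(t) − ∇U(s)‖ ≤ L |t − s|` on `(−∞, 0)` (clause `k = 1` of
`KNSS2009_regularity_boundedWeak_ancient`), then `t ↦ curl U(t) (x)` is continuous on `(−∞, 0)`
for every `x`. [folklore] -/
theorem continuousOn_curl_of_lipschitz
    {U : ℝ → EuclideanSpace ℝ (Fin 3) → EuclideanSpace ℝ (Fin 3)}
    (hU : ∀ t < 0, ContDiff ℝ 1 (U t)) {L : ℝ}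
    (hlip : ∀ s < 0, ∀ t < 0, ∀ x,
      ‖iteratedFDeriv ℝ 1 (U t) x - iteratedFDeriv ℝ 1 (U s) x‖ ≤ L * |t - s|)
    (x : EuclideanSpace ℝ (Fin 3)) : ContinuousOn (fun t => curl (U t) x) (Iio 0) := by
  -- the Jacobian is Lipschitz in time
  have hD : ∀ s < 0, ∀ t < 0, ‖fderiv ℝ (U t) x - fderiv ℝ (U s) x‖ ≤ L * |t - s| := by
    intro s hs t ht
    have h := hlip s hs t ht x
    rwa [← iteratedFDeriv_sub_apply (hU t ht).contDiffAt (hU s hs).contDiffAt,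
      norm_iteratedFDeriv_one, fderiv_sub ((hU t ht).differentiable one_ne_zero x)
        ((hU s hs).differentiable one_ne_zero x)] at h
  rw [Metric.continuousOn_iff]
  intro t ht ε hε
  set K := ‖(curlCLM : (EuclideanSpace ℝ (Fin 3) →L[ℝ] EuclideanSpace ℝ (Fin 3)) →L[ℝ]
    EuclideanSpace ℝ (Fin 3))‖ with hK
  refine ⟨ε / ((K + 1) * (|L| + 1)), by positivity, fun s hs hst => ?_⟩
  rw [dist_eq_norm, curl_eq_curlCLM, curl_eq_curlCLM, ← map_sub]
  have h1 : ‖curlCLM (fderiv ℝ (U s) x - fderiv ℝ (U t) x)‖ ≤ K * (L * |s - t|) :=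
    (ContinuousLinearMap.le_opNorm _ _).trans
      (mul_le_mul_of_nonneg_left (hD t ht s hs) (by positivity))
  have h2 : |s - t| < ε / ((K + 1) * (|L| + 1)) := by rwa [dist_eq_norm, Real.norm_eq_abs] at hst
  have hK0 : 0 ≤ K := by positivity
  calc ‖curlCLM (fderiv ℝ (U s) x - fderiv ℝ (U t) x)‖ ≤ K * (L * |s - t|) := h1
    _ ≤ (K + 1) * ((|L| + 1) * |s - t|) := by
        have : L * |s - t| ≤ (|L| + 1) * |s - t| :=
          mul_le_mul_of_nonneg_right ((le_abs_self L).trans (by linarith)) (abs_nonneg _)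
        nlinarith [abs_nonneg (s - t), abs_nonneg L]
    _ = ((K + 1) * (|L| + 1)) * |s - t| := by ring
    _ < ((K + 1) * (|L| + 1)) * (ε / ((K + 1) * (|L| + 1))) :=
        mul_lt_mul_of_pos_left h2 (by positivity)
    _ = ε := by field_simp

/-- **The structure of the vorticity at every time.** For the representative `U` of §4 (`C²`
slices with first derivatives Lipschitz in time), if `V(t, ·) = U(t, ·) + b(t)` is axisymmetric
and swirl free for a.e. `t < 0` (`ae_isAxisymmetric_hasNoSwirl_repr`), then for **every** `t < 0`
the vorticity `ω = curl U(t, ·)` (`= curl V(t, ·)`) satisfies `ω₂ = 0` and `x₀ω₀ + x₁ω₁ = 0`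
(KNSS p. 9: "for axi-symmetric flows without swirl we have `ω_r = 0`, `ω_z = 0`";
`AxisymNoSwirlVorticity` at good times, continuity in time and density of good times at the
others) — the hypotheses `h2`, `hb` of `integral_scalarEq_of_vorticityEq`. [cite: KochNadirashviliSereginSverak2009, §5 p. 9 (before (5.10)) and proof of Thm 5.2 (p. 10)] -/
theorem curl_structure_of_ae_repr
    {U : ℝ → EuclideanSpace ℝ (Fin 3) → EuclideanSpace ℝ (Fin 3)} {b : ℝ → EuclideanSpace ℝ (Fin 3)}
    (hU : ∀ t < 0, ContDiff ℝ 2 (U t)) {L : ℝ}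
    (hlip : ∀ s < 0, ∀ t < 0, ∀ x,
      ‖iteratedFDeriv ℝ 1 (U t) x - iteratedFDeriv ℝ 1 (U s) x‖ ≤ L * |t - s|)
    (hgood : ∀ᵐ t ∂((volume : Measure ℝ).restrict (Iio 0)),
      IsAxisymmetric (fun x => U t x + b t) ∧ HasNoSwirl (fun x => U t x + b t)) :
    ∀ t < 0, ∀ x, curl (U t) x 2 = 0 ∧ x 0 * curl (U t) x 0 + x 1 * curl (U t) x 1 = 0 := by
  have hU1 : ∀ t < 0, ContDiff ℝ 1 (U t) := fun t ht => (hU t ht).of_le one_le_two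
  -- `curl V = curl U`
  have hcurlV : ∀ t < 0, ∀ x, curl (fun y => U t y + b t) x = curl (U t) x := fun t ht x => by
    rw [curl_eq_curlCLM, curl_eq_curlCLM, fderiv_add_const]
  -- at good times
  have hgood' : ∀ᵐ t ∂((volume : Measure ℝ).restrict (Iio 0)), ∀ x,
      curl (U t) x 2 = 0 ∧ x 0 * curl (U t) x 0 + x 1 * curl (U t) x 1 = 0 := by
    filter_upwards [hgood, ae_restrict_mem measurableSet_Iio] with t hg ht x
    have ht' : t < 0 := ht
    have hV2 : ContDiff ℝ 2 fun y => U t y + b t := (hU t ht').add contDiff_const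
    have hV1 : ContDiff ℝ 1 fun y => U t y + b t := hV2.of_le one_le_two
    refine ⟨?_, ?_⟩
    · rw [← hcurlV t ht' x]; exact curl_apply_two_eq_zero hg.1 hg.2 hV1 x
    · rw [← hcurlV t ht' x]
      exact inner_curl_horizontal_eq_zero hg.1 hg.2 ((hV1.differentiable one_ne_zero) x)
  -- at every time, by continuity
  intro t ht x
  have hc := continuousOn_curl_of_lipschitz hU1 hlip x
  have hc2 : ContinuousOn (fun s => curl (U s) x 2) (Iio 0) :=
    (contDiff_piLp_apply (𝕜 := ℝ) (p := 2) (n := 0) (i := (2 : Fin 3))).continuous.comp_continuousOn hc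
  have hch : ContinuousOn (fun s => x 0 * curl (U s) x 0 + x 1 * curl (U s) x 1) (Iio 0) :=
    (continuousOn_const.mul ((contDiff_piLp_apply (𝕜 := ℝ) (p := 2) (n := 0)
      (i := (0 : Fin 3))).continuous.comp_continuousOn hc)).add
      (continuousOn_const.mul ((contDiff_piLp_apply (𝕜 := ℝ) (p := 2) (n := 0)
      (i := (1 : Fin 3))).continuous.comp_continuousOn hc))
  exact ⟨forall_eq_zero_of_ae_restrict_Iio hc2 (hgood'.mono fun s hs => (hs x).1) t ht,
    forall_eq_zero_of_ae_restrict_Iio hch (hgood'.mono fun s hs => (hs x).2) t ht⟩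

end Literature.Analysis.FluidPDE

end
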